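import Mathlib
import HarnessLib
import Summits.ResolutionOfSingularities.ResolutionOfSingularities.Theorems.WeightedInvariantDatumToEmbeddedQuotientBaseGraded

/-!
# S1a — R4c cusp COVER glue: points of a producer chart read as primes of the CHART RING (degree-0 lying over)

[OURS · L1 W4.5c · leafhand-res-wildquotients-7 g1] — NOT statements of the manuscript; counted 0; AI-level work, weaker than expert review. Crux
stmt-ResolutionOfSingularities-17941 `CyclicQuotientFourfolds`, line `s1a-logminvertex` v13 (`stub_reachLowerInFX`), R4c `cusp_killsIn_two` (crux-dir skeleton v2,
`Lines/s1a_logminvertex-R4c-PROGRESS-v2.md`, COVER obligation: "residual points lie in the member opens"; hand-7 g0 census item (a)/(C1), "scheme translation").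

The producer charts `O′ᵢⱼ` of the move atlas are affine with `E : Γ(M.V, O′ᵢⱼ) ≃+* (R_c)₀`, the degree-`0` part of the chart NODE grading of the chart ring
`R_c` (✓`exists_moveAtlas_of_nodes`); the ring certificates of the cusp assembly (✓`KillCert.QhSym.cuspO_bHat_not_mem_of_residualSections`, …) are statements about
PRIMES OF `R_c`. This file supplies the bridge, for any affine open `W` of any scheme and any graded commutative ring `R` with `E : Γ(X, W) ≃+* R₀`:
* ★ `exists_isPrime_forall_mem_basicOpen_iff` — every point `v ∈ W` is read by a prime `Q ⊂ R`: `v ∈ D(z) ↔ (E z : R) ∉ Q` for all sections `z`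
  (the prime of `v` in `Γ(X, W) ≅ R₀` lies under a prime of `R`: degree-zero lying over ✓`DatumToEmbedded.QuotientBase.exists_isPrime_comap_eq_of_degreeZero`,
  i.e. surjectivity of the good quotient `Spec R → Spec R₀`);
* ★ `mem_basicOpen_of_forall_isPrime` — hence a prime-ideal certificate "`E z₀, E z₁ ∈ Q ⇒ E b ∉ Q` for all primes `Q ⊂ R`" places every point off
  `D(z₀) ∪ D(z₁)` inside `D(b)` (the shape of the COVER obligation: residual points of `O′ᵢⱼ` lie in the member open `U = D(b)`).
-/

set_option linter.dupNamespace false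

noncomputable section

open CategoryTheory AlgebraicGeometry TopologicalSpace Opposite

namespace Summit.ResolutionOfSingularities.ResolutionOfSingularities.Theorems.WildQuotientResolution.S1.BlowupCharts

universe u

/-- Membership in a basic open in terms of the prime of the point (the tree's ✓`Literature.AlgebraicGeometry.Resolution.mem_basicOpen_iff_not_mem_primeIdealOf`,
restated for a bare `IsAffineOpen` to keep the rewriting syntactic). [folklore] [cite: StacksProject, Tag 01HR] -/
theorem mem_basicOpen_iff_not_mem_primeIdealOf' {X : Scheme.{u}} {W : X.Opens} (hW : IsAffineOpen W) {v : X} (hv : v ∈ W)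
    (z : Γ(X, W)) : v ∈ X.basicOpen z ↔ z ∉ (hW.primeIdealOf ⟨v, hv⟩).asIdeal := by
  rw [← PrimeSpectrum.mem_basicOpen, ← hW.fromSpec_preimage_basicOpen z]
  change _ ↔ hW.fromSpec (hW.primeIdealOf ⟨v, hv⟩) ∈ X.basicOpen z
  rw [hW.fromSpec_primeIdealOf ⟨v, hv⟩]

/-- ★ **Points of an affine open read as primes of a graded ring with the same degree-0 part.** If `W` is an affine open of a scheme `X` and
`E : Γ(X, W) ≃+* R₀` identifies its sections with the degree-`0` part of a graded commutative ring `R`, then for every point `v ∈ W` there is a prime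
`Q ⊂ R` with `v ∈ D(z) ↔ (E z : R) ∉ Q` for every section `z ∈ Γ(X, W)` (the prime of `v` lies under a prime of `R`: the good quotient `Spec R → Spec R₀`
is surjective). [OURS · L1 W4.5c · R4c COVER glue; folklore (Mumford, GIT, Thm 1.1)] -/
theorem exists_isPrime_forall_mem_basicOpen_iff {X : Scheme.{u}} {W : X.Opens} (hW : IsAffineOpen W)
    {ι R σ : Type*} [DecidableEq ι] [AddMonoid ι] [CommRing R] [SetLike σ R] [AddSubmonoidClass σ R]
    (𝓡 : ι → σ) [GradedRing 𝓡] (E : Γ(X, W) ≃+* ↥(𝓡 0)) {v : X} (hv : v ∈ W) :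
    ∃ Q : Ideal R, Q.IsPrime ∧ ∀ z : Γ(X, W), v ∈ X.basicOpen z ↔ ((E z : ↥(𝓡 0)) : R) ∉ Q := by
  let ψ : Γ(X, W) →+* R := (algebraMap (↥(𝓡 0)) R).comp (E : Γ(X, W) →+* ↥(𝓡 0))
  have hψE : ∀ c, ψ c = ((E c : ↥(𝓡 0)) : R) := fun _ => rfl
  have hψ : ∀ c, ψ c ∈ 𝓡 0 := fun c => by rw [hψE]; exact (E c).2
  have hsurj : ∀ x ∈ 𝓡 0, ∃ c, ψ c = x := fun x hx => ⟨E.symm ⟨x, hx⟩, by rw [hψE, RingEquiv.apply_symm_apply]⟩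
  have hinj : Function.Injective ψ := fun c d h => E.injective (Subtype.ext (by rw [← hψE, ← hψE]; exact h))
  obtain ⟨Q, hQ, hQc⟩ := DatumToEmbedded.QuotientBase.exists_isPrime_comap_eq_of_degreeZero 𝓡 hψ hsurj hinj (hW.primeIdealOf ⟨v, hv⟩).asIdeal
  refine ⟨Q, hQ, fun z => ?_⟩
  rw [mem_basicOpen_iff_not_mem_primeIdealOf' hW hv z, ← hQc, Ideal.mem_comap, hψE]

/-- ★ **Prime-ideal certificates place residual points in a member open.** In the situation of `exists_isPrime_forall_mem_basicOpen_iff`, if for every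
prime `Q ⊂ R` containing `E z₀` and `E z₁` one has `E b ∉ Q`, then every point of `W` off `D(z₀) ∪ D(z₁)` lies in `D(b)`. This is the shape of the
COVER obligation of ✓`killsIn_one_of_sectionCharts_of_associated` for the cusp assembly: `z₀, z₁` the residual sections of a producer chart, `b` the
member-defining section (e.g. ✓`KillCert.QhSym.cuspO_bHat_not_mem_of_residualSections` at `O`). [OURS · L1 W4.5c · R4c COVER glue] -/
theorem mem_basicOpen_of_forall_isPrime {X : Scheme.{u}} {W : X.Opens} (hW : IsAffineOpen W)
    {ι R σ : Type*} [DecidableEq ι] [AddMonoid ι] [CommRing R] [SetLike σ R] [AddSubmonoidClass σ R]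
    (𝓡 : ι → σ) [GradedRing 𝓡] (E : Γ(X, W) ≃+* ↥(𝓡 0)) {v : X} (hv : v ∈ W) (z₀ z₁ b : Γ(X, W))
    (h : ∀ Q : Ideal R, Q.IsPrime → ((E z₀ : ↥(𝓡 0)) : R) ∈ Q → ((E z₁ : ↥(𝓡 0)) : R) ∈ Q → ((E b : ↥(𝓡 0)) : R) ∉ Q)
    (h₀ : v ∉ X.basicOpen z₀) (h₁ : v ∉ X.basicOpen z₁) : v ∈ X.basicOpen b := by
  obtain ⟨Q, hQ, hiff⟩ := exists_isPrime_forall_mem_basicOpen_iff hW 𝓡 E hv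
  rw [hiff, not_not] at h₀ h₁
  rw [hiff]
  exact h Q hQ h₀ h₁

/-- **Variant with a family of residual sections** (any index type): if every prime of `R` containing all `E (z l)` misses `E b`, then the common zero set
of the `z l` inside `W` lies in `D(b)`. [OURS · L1 W4.5c · R4c COVER glue] -/
theorem mem_basicOpen_of_forall_isPrime_family {X : Scheme.{u}} {W : X.Opens} (hW : IsAffineOpen W)
    {ι R σ : Type*} [DecidableEq ι] [AddMonoid ι] [CommRing R] [SetLike σ R] [AddSubmonoidClass σ R]
    (𝓡 : ι → σ) [GradedRing 𝓡] (E : Γ(X, W) ≃+* ↥(𝓡 0)) {v : X} (hv : v ∈ W) {L : Type*} (z : L → Γ(X, W)) (b : Γ(X, W))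
    (h : ∀ Q : Ideal R, Q.IsPrime → (∀ l, ((E (z l) : ↥(𝓡 0)) : R) ∈ Q) → ((E b : ↥(𝓡 0)) : R) ∉ Q)
    (hz : ∀ l, v ∉ X.basicOpen (z l)) : v ∈ X.basicOpen b := by
  obtain ⟨Q, hQ, hiff⟩ := exists_isPrime_forall_mem_basicOpen_iff hW 𝓡 E hv
  rw [hiff]
  exact h Q hQ fun l => by have h' := hz l; rwa [hiff, not_not] at h'

end Summit.ResolutionOfSingularities.ResolutionOfSingularities.Theorems.WildQuotientResolution.S1.BlowupCharts

end
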